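import Summits.BirchSwinnertonDyer.BirchSwinnertonDyer.Theorems.AnticyclotomicTowerTorsionFiniteOfNoRationalCM
import Summits.BirchSwinnertonDyer.Rank1Residual.X12.CMRamifiedAdditive
import Literature.NumberTheory.EllipticCurves.BurungaleCastellaSkinnerTian2022.CMPConverse
import Literature.NumberTheory.EllipticCurves.ModularityVersionApProofs
import Literature.NumberTheory.QuadraticFields.DiscriminantOfSqrt
import Literature.NumberTheory.QuadraticFields.KroneckerSplitting
import Literature.NumberTheory.EllipticCurves.ComplexMultiplicationEndomorphismFieldOfDefinition
import HarnessLib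

/-!
# Crux `PrintCf2.SplitBadTwoRankOneOfFacts` (item 20368), line `eisenstein_two_bdp_line` v8.1 — `stub_finGlob_two` ON HEEGNER FIELDS,
# modulo ONE cite-level fact (the field of definition of CM endomorphisms, Silverman *AT* II.2.2)

Cell `bsd-print-cf2`, seat `bsd-line-cf2-p1-w2` g4 (prover, width seat on crux stmt-BirchSwinnertonDyer-20368; no live lead). `--supports
stmt-BirchSwinnertonDyer-20368` (helper). ROUTE-FREE (the stub body is spelled out; no `Theses.*` import). THEOREMS ONLY (0 definitions, 0 `sorry`); CONDITIONAL on ONE named fact of the tree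
(`Literature.NumberTheory.EllipticCurves.hasRationalCM_baseChange_imp_isSquare_cmFieldDiscr`, Silverman *AT* II.2.2, p630138). BSD is not advanced by
any of this; no summit statement is proved by this seat.

WHAT THIS IS. The registered `stub_finGlob_two` reads: for `W` in the split-bad CM class (`HasCM`, `r_an = 1`, `CMSplit W 2`, `¬ Good W 2`),
EVERY imaginary quadratic `K` and every anticyclotomic `ℤ₂`-extension `κ`: `Finite (E_K(K̄)[2^∞]^{ker κ})`, `E_K = W.baseChange K`. The cell's
general theorem `WeierstrassCurve.finGlob_of_not_hasRationalCM` (p629341: stable image + Shafarevich + `det = ε` + the norm-residue element)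
gives this for every `K` in which `2` splits and over which `E_K` has NO `K`-rational CM. On the class: `CMSplit W 2` pins the CM field
`ℚ(√−7)` (`cmFieldDiscrOfJ_eq_of_cmSplit_two`), hence `7 ∣ N_W` (`7` ramified in the CM field ⟹ bad at `7`, `X12.not_good_of_cmRamified`),
so a HEEGNER field `K` of `N_W` has `2` and `7` split — in particular `√−7 ∉ K` (`θ² = −7` would force `d_K = −7`, `7` ramified). The one
input that is not a tree theorem is the converse of the tree's `hasRationalCM_baseChange_of_isCMFieldOfJ` (Silverman *AT* II.2.2(b) ⟸):
«`E_L` has `L`-rational CM only if the CM field embeds in `L`» — Silverman *AT* II §2 Thm. 2.2 (a) `[α]^σ = [α^σ]` + (b), the tree's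
named fact `hasRationalCM_baseChange_imp_isSquare_cmFieldDiscr` (cite-level, statement-only; p630138). Hence:
* `not_isSquare_neg_seven_of_split_seven` — `7` split in an imaginary quadratic `K` ⟹ `−7` is not a square in `K`;
* `seven_dvd_conductorNorm_of_cmSplit_two` — on the class, `7 ∣ N_W`; `two_dvd_conductorNorm_of_not_good_two` — `2 ∣ N_W`;
* **`finGlob_two_of_heegner`** — GRANTED the named fact: the body of `stub_finGlob_two` with the binders `W.conductorNorm ℤ = N`,
  `SatisfiesHeegnerHypothesis N K` ADDED (the only fields at which the line's composition `_of_stubs` invokes the socket). The registered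
  binder «any imaginary quadratic `K`» also admits `K = ℚ(√−7)`, over which `E_K` HAS rational CM and the no-CM road does not apply
  (there the two CM lines and the `𝔮`-ramified towers decide; not attempted) — RESHAPE ADVISED to the Heegner form proved here.

References: [SilvermanATAEC1994] II §2 Thm. 2.2 (a),(b), Prop. II.1.1, App. A §3; [GreenbergLNM1716] §1 p. 62; [Marcus2018] Ch. 2 Thm. 1,
Ch. 3 Thm. 25; [SilvermanAEC2009] Cor. VII.7.2 (bad reduction at ramified CM primes, via the tree).
-/

noncomputable section

open scoped Classical

namespace Summit.BirchSwinnertonDyer.BirchSwinnertonDyer.Theorems.PrintCf2.EisensteinTwo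

open NumberField IsDedekindDomain Field WeierstrassCurve
  Literature.NumberTheory.EllipticCurves Literature.NumberTheory.EllipticCurves.Rank1Residual
  Literature.NumberTheory.EllipticCurves.GreenbergSelmer Literature.NumberTheory.GaloisRepresentations
  Summit.BirchSwinnertonDyer.Rank1Residual Summit.BirchSwinnertonDyer.Rank1Residual.X11b

set_option linter.dupNamespace false
set_option autoImplicit false

/-! ## §1 Heegner fields of the class: `√−7 ∉ K`, `7 ∣ N_W`, `2 ∣ N_W` -/

section Heegner

variable {K : Type} [Field K] [NumberField K]

/-- **If `7` splits in the imaginary quadratic field `K`, then `−7` is not a square in `K`**: `θ² = −7` forces `d_K = −7`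
(`discr_eq_of_sq_eq_intCast_of_neg`: `−7 ≡ 1 (mod 4)` squarefree), and then the Legendre symbol `(d_K/7) = 0 ≠ 1`, so `7` does not split
(`ncard_primesOver_eq_two_iff_legendreSym`). [cite: Marcus2018, Ch. 2 Thm. 1 and Ch. 3 Thm. 25] -/
theorem not_isSquare_neg_seven_of_split_seven (hK : IsImaginaryQuadratic K)
    (h7 : ((Ideal.span {((7 : ℕ) : ℤ)}).primesOver (𝓞 K)).ncard = 2) :
    ¬ IsSquare (((-7 : ℤ)) : K) := by
  rintro ⟨θ, hθ⟩
  have hsq : θ ^ 2 = ((-7 : ℤ) : K) := by rw [sq]; exact hθ.symm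
  have hsf : Squarefree (-7 : ℤ) := (Int.prime_iff_natAbs_prime.mpr (by norm_num)).squarefree
  have hd : NumberField.discr K = -7 :=
    Literature.NumberTheory.QuadraticFields.Quadratic.discr_eq_of_sq_eq_intCast_of_neg hK.1 hsq (by norm_num) (by decide) hsf
  haveI : Fact (Nat.Prime 7) := ⟨by norm_num⟩
  have h := (Literature.NumberTheory.QuadraticFields.Quadratic.ncard_primesOver_eq_two_iff_legendreSym (K := K) hK.1
    (p := 7) (by norm_num)).mp h7
  rw [hd] at h
  have h0 : legendreSym 7 (-7) = 0 := by
    rw [legendreSym.eq_zero_iff]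
    exact (ZMod.intCast_zmod_eq_zero_iff_dvd (-7) 7).mpr (by norm_num)
  rw [h0] at h
  exact zero_ne_one h

/-- **On the split-bad class, `7 ∣ N_W`**: `CMSplit W 2` pins the CM field `ℚ(√−7)` (`cmFieldDiscrOfJ W.j = −7`), so `7` is RAMIFIED in the
CM field, hence `W` has bad (additive) reduction at `7` (`X12.not_good_of_cmRamified`, Silverman *AEC* VII.7.2 via the tree), i.e.
`7 ∣ N_W` (`dvd_conductorNorm_iff_not_hasGoodReductionAtPrime`). [cite: SilvermanAEC2009, Cor. VII.7.2] -/
theorem seven_dvd_conductorNorm_of_cmSplit_two (W : WeierstrassCurve ℚ) [W.IsElliptic] (hCM : W.HasCM) (hsplit : CMSplit W 2) :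
    7 ∣ W.conductorNorm ℤ := by
  haveI : Fact (Nat.Prime 7) := ⟨by norm_num⟩
  have hd : cmFieldDiscrOfJ W.j = -7 := BurungaleCastellaSkinnerTian2022.cmFieldDiscrOfJ_eq_of_cmSplit_two W hsplit
  have hram : CMRamified W 7 := by
    change ((7 : ℕ) : ℤ) ∣ cmFieldDiscrOfJ W.j
    rw [hd]; norm_num
  have hbad : ¬ Good W 7 := X12.not_good_of_cmRamified W 7 hCM (by norm_num) hram
  exact (W.dvd_conductorNorm_iff_not_hasGoodReductionAtPrime 7).mpr hbad

/-- **`¬ Good W 2 ⟹ 2 ∣ N_W`** (bad reduction at `2` is `2 ∣ N`; `dvd_conductorNorm_iff_not_hasGoodReductionAtPrime`).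
[cite: DiamondShurman2005, §8.3 (the conductor is supported on the bad primes)] -/
theorem two_dvd_conductorNorm_of_not_good_two (W : WeierstrassCurve ℚ) [W.IsElliptic] (hng : ¬ Good W 2) :
    2 ∣ W.conductorNorm ℤ :=
  (W.dvd_conductorNorm_iff_not_hasGoodReductionAtPrime 2).mpr hng

/-- **No rational CM over a Heegner field of the class** (GRANTED the named fact): for `W` with CM and `CMSplit W 2`, and `K` an imaginary
quadratic field satisfying the Heegner hypothesis for `N_W`: `¬ (W.baseChange K).HasRationalCM` (`7 ∣ N_W` splits in `K`, so `√−7 ∉ K`).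
[cite: SilvermanATAEC1994, II §2 Thm. 2.2 (a),(b)] -/
theorem not_hasRationalCM_baseChange_of_heegner (hAT : hasRationalCM_baseChange_imp_isSquare_cmFieldDiscr)
    (W : WeierstrassCurve ℚ) [W.IsElliptic] (hCM : W.HasCM) (hsplit : CMSplit W 2)
    (hK : IsImaginaryQuadratic K) {N : ℕ} (hN : W.conductorNorm ℤ = N) (hHN : SatisfiesHeegnerHypothesis N K) :
    ¬ (W.baseChange K).HasRationalCM := by
  intro hrat
  have hd : cmFieldDiscrOfJ W.j = -7 := BurungaleCastellaSkinnerTian2022.cmFieldDiscrOfJ_eq_of_cmSplit_two W hsplit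
  have h7N : (7 : ℕ) ∣ N := by
    have h := seven_dvd_conductorNorm_of_cmSplit_two W hCM hsplit
    rw [hN] at h
    exact_mod_cast h
  have h7 := hHN 7 (by norm_num) h7N
  have hsq : IsSquare ((cmFieldDiscrOfJ W.j : ℤ) : K) := hAT W hCM K hrat
  rw [hd] at hsq
  exact not_isSquare_neg_seven_of_split_seven hK h7 hsq

end Heegner

/-! ## §2 `stub_finGlob_two` on Heegner fields (modulo the named fact) -/

/-- **`stub_finGlob_two` ON HEEGNER FIELDS, modulo Silverman *AT* II.2.2.** For `W` in the split-bad CM class (`W.HasCM`, `r_an(W) = 1`,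
`CMSplit W 2`, `¬ Good W 2`), every imaginary quadratic `K` satisfying the Heegner hypothesis for `N_W`, and every anticyclotomic
`ℤ₂`-extension `κ` of `K`: `E_K(K̄)[2^∞]^{ker κ} = E_K(K_∞)[2^∞]` is FINITE (`E_K = W.baseChange K`). = the registered `stub_finGlob_two` with the
binders `W.conductorNorm ℤ = N`, `SatisfiesHeegnerHypothesis N K` added (the generality the line's `_of_stubs` consumes). Proof:
`finGlob_of_not_hasRationalCM` (p629341) at `p = 2` — `2 ∣ N_W` splits in `K`, and `E_K` has no `K`-rational CM by §1. CONDITIONAL on `hAT`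
only; `r_an = 1` is not used. [cite: GreenbergLNM1716, §1 p. 62] [cite: SilvermanATAEC1994, II §2 Thm. 2.2 (a),(b)] -/
theorem finGlob_two_of_heegner (hAT : hasRationalCM_baseChange_imp_isSquare_cmFieldDiscr) :
    ∀ (W : WeierstrassCurve ℚ) [W.IsElliptic] [W.IsGloballyMinimal],
      W.HasCM → W.analyticRank = 1 → CMSplit W 2 → ¬ Good W 2 →
      ∀ (N : ℕ) [NeZero N] (K : Type) [Field K] [NumberField K],
        W.conductorNorm ℤ = N → IsImaginaryQuadratic K → SatisfiesHeegnerHypothesis N K →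
        ∀ (κ : ZpExtension K 2), κ.IsAnticyclotomic →
          Finite (FixedPoints.addSubgroup κ.kerSubgroup (geomPrimaryTorsion (W.baseChange K) 2)) := by
  intro W _ _ hCM _hr hsplit hng N _ K _ _ hN hK hHN κ hκ
  have h2N : (2 : ℕ) ∣ N := by
    have h := two_dvd_conductorNorm_of_not_good_two W hng
    rw [hN] at h
    exact_mod_cast h
  have hsplit2 : SplitsIn K 2 := hHN 2 Nat.prime_two h2N
  have hCM' : ¬ (W.baseChange K).HasRationalCM := not_hasRationalCM_baseChange_of_heegner hAT W hCM hsplit hK hN hHN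
  exact W.finGlob_of_not_hasRationalCM 2 hK hsplit2 hCM' κ hκ

end Summit.BirchSwinnertonDyer.BirchSwinnertonDyer.Theorems.PrintCf2.EisensteinTwo

end
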